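import Summits.HodgeConjecture.HodgeConjecture.Theorems.F0LD2LineThetaTypesComplementaryDefs
import Summits.HodgeConjecture.HodgeConjecture.Theorems.F0LD2SeparationOfBlockZeroTrace
import Summits.HodgeConjecture.HodgeConjecture.Theorems.F0LD1SameLabelRigidityOfOrgan
import HarnessLib

/-!
# LD letter «R₂» (★ `LemD1RankTwoCMLetters.LemD1_4SameLabelNonsplitCM₂`, [Liu2021, Lem. D.1 (4)] «only if», same label) FROM THE ONE RANK-ONE ORGAN
# `LineThetaTypesComplementary₁` — the glue of LD2 leaf ED. 6 ∕ LD1 leaf ED. 5 (`stub_letter_R₂ := … stub_organ_lineTypes`)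

Cell `hodgecm-mathlib`, half A lines LD2 (socket `stub_S1b_facts`, #74R) and LD1 (socket `stub_S1_facts`, #73), seat LD2-p02 (g2), dealer LD2-plan (g2) DEALS #3e
(L3″)(b), 2026-09-02.  THEOREMS ONLY (no `def`, no named fact, no instance, no `sorry`); `--supports stmt-HodgeConjecture-24832`.

`lemD1_4SameLabelNonsplitCM₂_of_lineThetaTypesComplementary₁ (h : LineThetaTypesComplementary₁) : LemD1_4SameLabelNonsplitCM₂` — the composition, BY NAME, of
* ★ `F0LD1SameLabelRigidityOfOrgan.lemD1_4SameLabelNonsplitCM₂_of_forall_anisotropic_separation` (LD1-p01 (g2), p850235): R₂ from the separation `hsepA` of the two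
  transported rank-one theta lifts at every ANISOTROPIC non-split place (the isotropic places are ★ p850003, splitting-free);
* ★ `F0LD2SeparationOfBlockZeroTrace.hsep_cm_of_lineThetaTypesComplementary` (LD2-p01 (g2)): that separation at `v` from the organ's statement at `v` (rank-2 ↦
  rank-1 block restriction ★ `LocalSplittingCMBlockRestrictionPackage` (A-p19 (g30)), ★ `hsep_of_blockZero_complement_of_eq`, ★
  `blockComplement_of_finrank_weightSpace_add_eq_one`, ★ `rankOne_theta_lines_disjoint_of_blockComplement`), read at the rank-one frame `dV₁ := fun _ => dV 0`;
* the organ `h : LineThetaTypesComplementary₁` (★ def `F0LD2LineThetaTypesComplementaryDefs`) applied at `(L, fun _ => dV 0, λ, a, a′, v)` under the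
  non-split binder and hsep's guard.
HONEST LABEL: HC_CM is proved only modulo the 7 printed citations (2 remaining: hLiu418 = stmt-HodgeConjecture-24832, h413 = stmt-HodgeConjecture-24833) until
rung 0 closes; with this glue the leaves' letter stub `stub_letter_R₂` becomes a theorem over the organ stub `stub_organ_lineTypes` — R₂ [Liu2021 Lem. D.1 (4)]
leaves the letter list, replaced by the rank-one `(U(1),U(1))` dichotomy organ; count-neutral until that organ is paid.

## References
* [Liu2021] Y. Liu, Camb. J. Math. 9 (2021) = arXiv:2102.11518 — App. D Lem. D.1 (4) (p. 126, l. 5235), proof l. 5257–5262.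
* [HarrisKudlaSweet1996] M. Harris, S. Kudla, W. J. Sweet, J. AMS 9 (1996), Cor. 4.4, Thm. 6.1.
* [GanIchino2014] W. T. Gan, A. Ichino, Invent. Math. 195 (2014), Thm. 4.1.
-/

set_option autoImplicit false
set_option linter.dupNamespace false

noncomputable section

open scoped Matrix Kronecker
open NumberField IsDedekindDomain
open Literature.NumberTheory Literature.NumberTheory.Automorphic Literature.NumberTheory.Automorphic.UnitaryGroup
open Literature.NumberTheory.Automorphic.Liu2021 Literature.NumberTheory.Automorphic.Liu2021.Def411WeilCarriers
open Literature.NumberTheory.Automorphic.Liu2021.LemD1RankTwoCMLetters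
open Summit.HodgeConjecture.HodgeConjecture.Cruxes.HLiu418.F0LD2LineThetaTypesComplementaryDefs
open Summit.HodgeConjecture.HodgeConjecture.Cruxes.HLiu418.F0LD2SeparationOfBlockZeroTrace
open Summit.HodgeConjecture.HodgeConjecture.Cruxes.HLiu418.F0LD1SameLabelRigidityOfOrgan

namespace Summit.HodgeConjecture.HodgeConjecture.Cruxes.HLiu418.F0LD2LetterR2OfLineComplementary

set_option synthInstance.maxHeartbeats 400000 in
set_option maxHeartbeats 4000000 in -- the CM θ-package terms in the binders of both ★ inputs (as their files, 4 M)
/-- **R₂ FROM THE RANK-ONE LINE-TYPES ORGAN.**  If the two same-`λ` rank-one CM θ-package Weil representations on the two classes of hermitian lines have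
complementary type sets at every non-split place where the lines' Step-1 representatives differ (`LineThetaTypesComplementary₁`), then [Liu2021, Lem. D.1 (4)]
«only if», same label — ★ `LemD1_4SameLabelNonsplitCM₂` — holds: per place, isotropic ⇒ ★ p850003, anisotropic ⇒ LD2-p01's separation from the organ ⇒
LD1-p01's closer. [cite: Liu2021, App. D Lemma D.1 (4) (p. 126, l. 5235), proof l. 5257–5262] [cite: HarrisKudlaSweet1996, Cor. 4.4, Thm. 6.1] -/
theorem lemD1_4SameLabelNonsplitCM₂_of_lineThetaTypesComplementary₁ (h : LineThetaTypesComplementary₁) : LemD1_4SameLabelNonsplitCM₂ :=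
  lemD1_4SameLabelNonsplitCM₂_of_forall_anisotropic_separation
    fun L _ _ _ dV hdV hdV0 lam hlam _ a a' χ v hns _ hguard =>
      hsep_cm_of_lineThetaTypesComplementary L dV hdV hdV0 (fun _ => dV 0) (fun _ => hdV 0) (fun _ => hdV0 0) rfl lam hlam a a' χ v hns
        (h L (fun _ => dV 0) (fun _ => hdV 0) (fun _ => hdV0 0) lam hlam a a' v hns hguard) hguard

end Summit.HodgeConjecture.HodgeConjecture.Cruxes.HLiu418.F0LD2LetterR2OfLineComplementary

end
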